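import Summits.BirchSwinnertonDyer.Rank2.CountingDoorKernel
import Literature.NumberTheory.EllipticCurves.BSDInvariantsProofs
import HarnessLib

/-!
# Cell bsd-rank2 (TWIN leaf `PAdicBSDRankTwoPositiveProportion`, door D-count): the door from
# `rank = 2` and `Ш[p^∞] = ⊥` on the minimal model, and transport of `Ш[p^∞] = ⊥` along a change
# of variables (theorems only)

Cell-side file (cell bsd-rank2, seat bsd-rank2-lit GEN 10), companion of `CountingDoorKernel.lean`
(K1/K2/K4, `doorKernel_at_three`) for the `CountingBridge` prover of
`route-BirchSwinnertonDyer-CountingDoorF2AtThree`: the counting (K1 `#Sel₃ = 9 ⇒ rank = 2 ∧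
Ш[3^∞] = ⊥`, K2) is done on the family's own integer model `E_a` of a member of `F₂` (K1 is stated
for ANY elliptic equation over `ℚ`), while the leaf's `3`-adic clause is read on a GLOBALLY MINIMAL
model `C • E_a`; the rank transports by the tree theorem `mordellWeilRank_variableChange_holds`,
`Ш[p^∞] = ⊥` by `primaryComponent_sha_smul_eq_bot_iff` below (along the tree's
`galH1Equiv W C : H¹(K, W) ≃+ H¹(K, C • W)`, which maps `Ш(W)` onto `Ш(C • W)`), and the door then
runs from `rank = 2 ∧ Ш[3^∞] = ⊥` (`order_eq_two_of_rank_two_SU`,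
`order_eq_two_at_three_of_rank_two`) — no Selmer count is needed on the minimal model;
`rank_two_sha_bot_smul` packages the transport. No definition, no named fact, no instance; the
published inputs enter by name as hypotheses (`Schneider1985_order_charGenerator_odd`,
`mazur_tate_sigma_exists_odd`, `skinner_urban_main_conjecture`).

PARTITION: none — r_an ≥ 2, summit axis S0; TWIN (D-0056): n/a. B1 honesty: TWIN currency only —
the order of the cyclotomic `p`-adic `L`-function is read off the algebraic side through the main
conjecture; no analytic rank, no complex `L`-value.

References: Skinner–Urban, Invent. Math. 195 (2014) Thm 3.29 [SkinnerUrban2014]; P. Schneider,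
Invent. Math. 79 (1985) [Schneider1985]; J. H. Silverman, *AEC* X.§4 [SilvermanAEC2009];
`HOME/p2/PADIC-R2-G8.md` §3 (door D-count).
-/

noncomputable section

open scoped Classical
open WeierstrassCurve Literature.NumberTheory.EllipticCurves
  Literature.NumberTheory.EllipticCurves.ModularForms CongruenceSubgroup

namespace Summit.BirchSwinnertonDyer.Rank2

/-! ### Transport of `Ш[p^∞] = ⊥` (and of the rank) along a change of variables -/

section Transport

/-- A `p`-primary component is trivial as soon as it is trivial before an additive isomorphism. [folklore] -/
theorem primaryComponent_eq_bot_of_addEquiv {A B : Type*} [AddCommGroup A] [AddCommGroup B]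
    (e : A ≃+ B) (p : ℕ) [Fact p.Prime] (h : AddCommGroup.primaryComponent A p = ⊥) :
    AddCommGroup.primaryComponent B p = ⊥ := by
  rw [eq_bot_iff] at h ⊢
  intro y hy
  obtain ⟨k, hk⟩ := (AddCommGroup.mem_primaryComponent).mp hy
  have hx : e.symm y ∈ AddCommGroup.primaryComponent A p :=
    (AddCommGroup.mem_primaryComponent).mpr ⟨k, by rw [← map_nsmul, hk, map_zero]⟩
  have h0 : e.symm y = 0 := AddSubgroup.mem_bot.mp (h hx)
  rw [AddSubgroup.mem_bot, ← e.apply_symm_apply y, h0, map_zero]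

variable {K : Type} [Field K] [NumberField K] (W : WeierstrassCurve K) (C : VariableChange K)
  (p : ℕ) [Fact p.Prime]

/-- **`Ш[p^∞] = 0` is an isomorphism invariant**: for a change of variables `C`,
`Ш(C • W)[p^∞] = ⊥ ↔ Ш(W)[p^∞] = ⊥` (transport along the tree's `galH1Equiv W C : H¹(K, W) ≃+ H¹(K, C • W)`,
which maps `Ш(W)` onto `Ш(C • W)`, `mem_sha_iff_galH1Equiv_mem`; Silverman X.§4: `Ш` is attached to
`E/K`, not to an equation). [cite: SilvermanAEC2009, X.§4] -/
theorem primaryComponent_sha_smul_eq_bot_iff :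
    AddCommGroup.primaryComponent (C • W).sha p = ⊥ ↔ AddCommGroup.primaryComponent W.sha p = ⊥ := by
  have hmap : W.sha.map ((WeierstrassCurve.galH1Equiv W C : W.galH1 ≃+ (C • W).galH1) :
      W.galH1 →+ (C • W).galH1) = (C • W).sha := by
    ext y
    rw [AddSubgroup.mem_map]
    constructor
    · rintro ⟨x, hx, rfl⟩
      exact (WeierstrassCurve.mem_sha_iff_galH1Equiv_mem W C x).mp hx
    · intro hy
      refine ⟨(WeierstrassCurve.galH1Equiv W C).symm y, ?_, AddEquiv.apply_symm_apply _ y⟩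
      have h := WeierstrassCurve.mem_sha_iff_galH1Equiv_mem W C
        ((WeierstrassCurve.galH1Equiv W C).symm y)
      rw [AddEquiv.apply_symm_apply] at h
      exact h.mpr hy
  let e : W.sha ≃+ (C • W).sha :=
    ((WeierstrassCurve.galH1Equiv W C).addSubgroupMap W.sha).trans (AddEquiv.addSubgroupCongr hmap)
  exact ⟨primaryComponent_eq_bot_of_addEquiv e.symm p, primaryComponent_eq_bot_of_addEquiv e p⟩

/-- **Transport of the counted member's output to any other model**: `rank (C • W) = 2` and
`Ш(C • W)[p^∞] = ⊥` from `rank W = 2` and `Ш(W)[p^∞] = ⊥` (tree `mordellWeilRank_variableChange_holds`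
and `primaryComponent_sha_smul_eq_bot_iff`). [cite: SilvermanAEC2009, X.§4 and III.3.1(b)] -/
theorem rank_two_sha_bot_smul [W.IsElliptic] (hr : W.mordellWeilRank = 2)
    (hsha : AddCommGroup.primaryComponent W.sha p = ⊥) :
    (C • W).mordellWeilRank = 2 ∧ AddCommGroup.primaryComponent (C • W).sha p = ⊥ :=
  ⟨(mordellWeilRank_variableChange_holds W C).trans hr,
    (primaryComponent_sha_smul_eq_bot_iff W C p).mpr hsha⟩

end Transport

/-! ### The door from `rank = 2` and finite `Ш[p^∞]` (no Selmer count on the minimal model) -/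

section DoorFromRank

variable (W : WeierstrassCurve ℚ) [W.IsElliptic] [W.IsGloballyMinimal] (p : ℕ) [Fact p.Prime]

/-- **K4 from `rank = 2` and finite `Ш[p^∞]`**, at `p ≥ 3` via Skinner–Urban, modulo the named facts
`Schneider1985_order_charGenerator_odd`, `mazur_tate_sigma_exists_odd`,
`skinner_urban_main_conjecture W p`: with `E[p]` irreducible, good ordinary `p`, an auxiliary
multiplicative prime `ℓ ≠ p` with `p ∤ v_ℓ(Δ_min)`, Schneider's conjecture for the canonical height,
`rank E(ℚ) = 2` and `Ш(E)[p^∞]` finite, the `p`-adic `L`-function has `ord_{T=0} = 2` (clause 2 of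
Schneider 1985 / Perrin-Riou with the main conjecture in generator form).
[cite: SkinnerUrban2014, Thm 3.29] [cite: Schneider1985, Thm 2′ (p. 342)] -/
theorem order_eq_two_of_rank_two_SU (h85 : Schneider1985_order_charGenerator_odd)
    (hex : mazur_tate_sigma_exists_odd)
    {κ : ZpExtension ℚ p} {γ : Field.absoluteGaloisGroup ℚ} {N : ℕ} [NeZero N]
    {f : CuspForm (Gamma0 N) 2}
    (hSU : skinner_urban_main_conjecture W p (κ := κ) (γ := γ) (f := f))
    (hp : 3 ≤ p) (hgood : W.HasGoodReductionAtPrime p) (hord : ¬ (p : ℤ) ∣ W.frobeniusTrace p)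
    (hirr : W.HasIrreducibleModPGaloisRep p)
    (haux : ∃ ℓ : ℕ, ∃ _ : Fact ℓ.Prime, ℓ ≠ p ∧ W.HasMultiplicativeReductionAtPrime ℓ ∧
      ¬ p ∣ padicValInt ℓ W.minimalDiscriminantInt)
    (hκ : κ.IsCyclotomic) (hγ : κ.IsTopGenerator γ) (hγ' : IsCyclotomicVariable p γ)
    (hf : IsNewformOf W f) (D : W.SelmerDualData κ γ) [Module.Finite (IwasawaAlgebra p) D.X]
    (hR : ∀ Dh : PAdicHeightData W p, Dh.IsCanonical → SchneiderConjecture Dh)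
    (hr : W.mordellWeilRank = 2) (hfin : Finite (AddCommGroup.primaryComponent W.sha p)) :
    (padicLFunction f (unitRoot W p : ℚ_[p])).order = 2 := by
  obtain ⟨hX, ⟨g, k, hchar, hιg⟩, -⟩ := hSU hp hgood hord hirr haux hκ hγ hγ' hf D
  obtain ⟨Dh, hDh, -, hiff⟩ := h85.exists_canonical hex W p (by omega) hgood hord hκ hγ hγ' D hX hchar
  have hg2 : g.order = ((2 : ℕ) : ℕ∞) := by
    have h := hiff.mpr ⟨hR Dh hDh, hfin⟩
    rwa [hr] at h
  rw [order_eq_order_of_iwasawaToPowerSeries_eq p hιg, hg2]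
  rfl

end DoorFromRank

/-- **The `p = 3` door on a globally minimal model from `rank = 2` and `Ш[3^∞] = ⊥`** (the form the
`CountingBridge` prover needs after counting on the family's own model and transporting `rank` and
`Ш[3^∞] = ⊥` with `rank_two_sha_bot_smul`): modulo the three published inputs, a globally minimal
elliptic `W/ℚ`, good ordinary at `3`, `ρ̄₃` irreducible, with the auxiliary prime and Schneider's
conjecture at `3`, `rank W(ℚ) = 2` and `Ш(W)[3^∞] = 0`, has `ord_{T=0} L₃(f, α; T) = 2` for every
weight-two newform `f` of `W`. [cite: SkinnerUrban2014, Thm 3.29] -/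
theorem order_eq_two_at_three_of_rank_two (h85 : Schneider1985_order_charGenerator_odd)
    (hex : mazur_tate_sigma_exists_odd)
    (hSU : ∀ (W : WeierstrassCurve ℚ) [W.IsElliptic] [W.IsGloballyMinimal]
      (κ : ZpExtension ℚ 3) (γ : Field.absoluteGaloisGroup ℚ) {N : ℕ} [NeZero N]
      (f : CuspForm (Gamma0 N) 2), skinner_urban_main_conjecture W 3 (κ := κ) (γ := γ) (f := f))
    (W : WeierstrassCurve ℚ) [W.IsElliptic] [W.IsGloballyMinimal]
    (hord : IsOrdinaryAt W 3) (hirr : W.HasIrreducibleModPGaloisRep 3)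
    (haux : ∃ ℓ : ℕ, ∃ _ : Fact ℓ.Prime, ℓ ≠ 3 ∧ W.HasMultiplicativeReductionAtPrime ℓ ∧
      ¬ 3 ∣ padicValInt ℓ W.minimalDiscriminantInt)
    (hR : ∀ Dh : PAdicHeightData W 3, Dh.IsCanonical → SchneiderConjecture Dh)
    (hr : W.mordellWeilRank = 2) (hsha : AddCommGroup.primaryComponent W.sha 3 = ⊥) :
    ∀ ⦃N : ℕ⦄ [NeZero N] (f : CuspForm (Gamma0 N) 2), IsNewformOf W f →
      (padicLFunction f (unitRoot W 3 : ℚ_[3])).order = 2 := by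
  intro N _ f hf
  obtain ⟨κ, hκ, γ, hγ, hγ'⟩ := exists_isCyclotomic_isTopGenerator_isCyclotomicVariable_holds 3
  obtain ⟨D⟩ := W.nonempty_selmerDualData_holds κ γ hγ
  haveI : Module.Finite (IwasawaAlgebra 3) D.X := D.module_finite_holds hγ
  have hfin : Finite (AddCommGroup.primaryComponent W.sha 3) := by
    rw [hsha]; infer_instance
  exact order_eq_two_of_rank_two_SU W 3 h85 hex (hSU W κ γ f) le_rfl hord.1 hord.2 hirr haux hκ hγ hγ'
    hf D hR hr hfin

end Summit.BirchSwinnertonDyer.Rank2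

end
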